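import Mathlib
import Summits.Ventures.PercRepro2.Defs
import Summits.Ventures.PercRepro2.Independence
import Summits.Ventures.PercRepro2.Harris
import Summits.Ventures.PercRepro2.Graph
import Summits.Ventures.PercRepro2.Events
import Summits.Ventures.PercRepro2.Induced
import Summits.Ventures.PercRepro2.BHK
import Summits.Ventures.PercRepro2.BHKEvents

/-!
# The R-product inequality (Theorem B of proofs/MINE2-JOINTPA.md) and (SUB2)
(blind cell PercRepro2, mine-2 g19)

Roots `s, t`, `Q = {s ↮ t}`; for a finite vertex set `T`, `{W : Set V | ∀ x ∈ T, x ∉ W} = {W | T ∩ W = ∅}` (a down-set),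
so `{C_s ∈ {W : Set V | ∀ x ∈ T, x ∉ W}} ∩ Q = R_{{t} ∪ T}` is a van den Berg–Häggström–Kahn non-connection event of the
source `s`: conditioning on it preserves the positive association of `C_s` (BHK06 Thm 1.3, the
tree's `bhk_induced`).  For an up-set `𝓤` of the OTHER cluster `C_t`, inside `Q`:
`P(𝓔; 𝓤) = P(C_s ∈ 𝓔, C_t ∈ 𝓤, Q)`, `P(𝓔) = P(C_s ∈ 𝓔, Q)`.

* `bhk_same_cluster_R`: `bhk_induced` on the whole graph at `X = Y = insert t T`;
* `cond_raises` (F1): `P({W : Set V | ∀ x ∈ T, x ∉ W} ∩ {W : Set V | ∀ x ∈ T, x ∉ W}′; 𝓤)·P({W : Set V | ∀ x ∈ T, x ∉ W}′) ≥ P({W : Set V | ∀ x ∈ T, x ∉ W}′; 𝓤)·P({W : Set V | ∀ x ∈ T, x ∉ W} ∩ {W : Set V | ∀ x ∈ T, x ∉ W}′)`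
  (one more non-connection of `C_s` raises `P(C_t ∈ 𝓤)`; `g = delClusterProb` is antitone);
* `avoid_pa` (F2): `P({W : Set V | ∀ x ∈ T, x ∉ W} ∩ {W : Set V | ∀ x ∈ T, x ∉ W}′)·P(Q) ≥ P({W : Set V | ∀ x ∈ T, x ∉ W})·P({W : Set V | ∀ x ∈ T, x ∉ W}′)`;
* **`r_product`** (Theorem B): `(P({W : Set V | ∀ x ∈ T, x ∉ W} ∩ {W : Set V | ∀ x ∈ T, x ∉ W}′; 𝓤)·P(Q) − P(C_t ∈ 𝓤, Q)·P({W : Set V | ∀ x ∈ T, x ∉ W} ∩ {W : Set V | ∀ x ∈ T, x ∉ W}′))·P(Q)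
  ≥ P({W : Set V | ∀ x ∈ T, x ∉ W})·(P({W : Set V | ∀ x ∈ T, x ∉ W}′; 𝓤)·P(Q) − P(C_t ∈ 𝓤, Q)·P({W : Set V | ∀ x ∈ T, x ∉ W}′))`, i.e.
  `Cov_Q(1_𝓤(C_t), M_T M_{T′}) ≥ P_Q(M_T)·Cov_Q(1_𝓤(C_t), M_{T′})`, `M_T = 1[C_s ∩ T = ∅]`.
  Proof: with `a, m, b, m′, m_T, f₀, P` the seven masses, (F1a) `a m′ ≥ b m`, (F1b) `b P ≥ f₀ m′`,
  (F2) `m P ≥ m_T m′`; `D₁ = aP − f₀m`, `D₂ = bP − f₀m′ ≥ 0`, `D₁ m′ ≥ m D₂`, `P m D₂ ≥ m_T m′ D₂`,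
  so `m′ (P D₁ − m_T D₂) ≥ 0`, and `m′ = 0` forces `a = b = m = 0`;
* **`sub2`** ((SUB2): `s = a₂`, `t = a₁`, `𝓤 = {b ∈ ·}`, `T = {o}`, `T′ = {u}`):
  `Cov_Q(1[b ∈ C₁], 1[o ∉ C₂]·1[u ∉ C₂]) ≥ P_Q(o ∉ C₂)·Cov_Q(1[b ∈ C₁], 1[u ∉ C₂])`, i.e.
  `|Cov_Q(L_b, H_oH_u)| ≤ |Cov_Q(L_b, H_o)| + P_Q(o ∈ C₂)·|Cov_Q(L_b, H_u)|` — a linear inequality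
  between three BHK-1.4 brackets (its «(J1)» shape for general positively associated measures is
  false; the BHK R-conditioning carries it).
-/

namespace Summit.Ventures.PercRepro2

namespace RProduct

section AvoidDef

variable {V : Type*} {R : Type*} [CommRing R] [LinearOrder R] [IsStrictOrderedRing R]

/-- `avoid ∅` is everything. -/
lemma avoid_empty : {W : Set V | ∀ x ∈ (∅ : Finset V), x ∉ W} = Set.univ := by
  ext W; simp

/-- `avoid (T ∪ T′) = avoid T ∩ avoid T′` (with `avoid T = {W | ∀ x ∈ T, x ∉ W}`). -/
lemma avoid_union [DecidableEq V] (T T' : Finset V) :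
    {W : Set V | ∀ x ∈ T ∪ T', x ∉ W} =
      {W : Set V | ∀ x ∈ T, x ∉ W} ∩ {W : Set V | ∀ x ∈ T', x ∉ W} := by
  ext W
  constructor
  · intro h
    exact ⟨fun x hx => h x (Finset.mem_union_left _ hx), fun x hx => h x (Finset.mem_union_right _ hx)⟩
  · rintro ⟨h1, h2⟩ x hx
    rcases Finset.mem_union.1 hx with hx | hx
    · exact h1 x hx
    · exact h2 x hx

/-- The indicator of `{W : Set V | ∀ x ∈ T, x ∉ W}` is antitone. -/
lemma antitone_indicator_avoid (T : Finset V) :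
    Antitone (({W : Set V | ∀ x ∈ T, x ∉ W}).indicator (1 : Set V → R)) := by
  intro W W' h
  by_cases hW' : W' ∈ {W : Set V | ∀ x ∈ T, x ∉ W}
  · have hW : W ∈ {W : Set V | ∀ x ∈ T, x ∉ W} := fun x hx hxW => hW' x hx (h hxW)
    simp [Set.indicator_of_mem hW, Set.indicator_of_mem hW']
  · rw [Set.indicator_of_notMem hW']
    exact Set.indicator_apply_nonneg fun _ => zero_le_one

/-- `1_𝓔 ≤ 1`. -/
lemma indicator_one_le_one (𝓔 : Set (Set V)) (W : Set V) :
    𝓔.indicator (1 : Set V → R) W ≤ 1 := by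
  by_cases hW : W ∈ 𝓔 <;> simp [hW]

end AvoidDef

section Events

variable {V : Type*} {E : Type*} {R : Type*} [CommRing R]

/-- `R^{univ}_{insert t T} = {s ↮ t} ∩ {C_s ∈ {W : Set V | ∀ x ∈ T, x ∉ W}}`. -/
lemma REvent_univ_insert [Fintype V] [DecidableEq V] (ends : E → Sym2 V) (s t : V)
    (T : Finset V) :
    REvent ends Finset.univ s (insert t T) =
      (connEvent ends s t)ᶜ ∩ clusterInEvent ends s ({W : Set V | ∀ x ∈ T, x ∉ W}) := by
  ext ω
  simp [REvent, Finset.coe_univ, induced_univ, clusterInEvent, cluster, connEvent]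

/-- `1_{C_s ∈ 𝓔}(ω) = 1_𝓔(C_s(ω))`. -/
lemma indicator_clusterInEvent (ends : E → Sym2 V) (s : V) (𝓔 : Set (Set V)) (ω : Config E) :
    (clusterInEvent ends s 𝓔).indicator (1 : Config E → R) ω = 𝓔.indicator 1 (cluster ends ω s) := by
  by_cases h : cluster ends ω s ∈ 𝓔 <;> simp [clusterInEvent, h]

end Events

section Avoid

variable {V : Type*} {E : Type*} [Fintype E] [DecidableEq E] [Fintype V] [DecidableEq V]
  {R : Type*} [CommRing R] [LinearOrder R] [IsStrictOrderedRing R]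

/-- **BHK 1.3 on `R = R_{{t} ∪ T} = {s ↮ t} ∩ {C_s ∈ {W : Set V | ∀ x ∈ T, x ∉ W}}`**: for nonnegative monotone
cluster functionals `F₁, F₂` of `C_s`, `E[F₁(C_s) 1_R] · E[F₂(C_s) 1_R] ≤ E[(F₁F₂)(C_s) 1_R] · P(R)`. -/
theorem bhk_same_cluster_R (p : E → R) (hp : IsProbVec p) (ends : E → Sym2 V) (s t : V)
    (T : Finset V) {F₁ F₂ : Set V → R} (hF₁ : Monotone F₁) (hF₂ : Monotone F₂)
    (hF₁0 : ∀ S, 0 ≤ F₁ S) (hF₂0 : ∀ S, 0 ≤ F₂ S) :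
    expect p (fun ω => F₁ (cluster ends ω s) *
        ((connEvent ends s t)ᶜ ∩ clusterInEvent ends s ({W : Set V | ∀ x ∈ T, x ∉ W})).indicator 1 ω) *
      expect p (fun ω => F₂ (cluster ends ω s) *
        ((connEvent ends s t)ᶜ ∩ clusterInEvent ends s ({W : Set V | ∀ x ∈ T, x ∉ W})).indicator 1 ω) ≤
    expect p (fun ω => F₁ (cluster ends ω s) * F₂ (cluster ends ω s) *
        ((connEvent ends s t)ᶜ ∩ clusterInEvent ends s ({W : Set V | ∀ x ∈ T, x ∉ W})).indicator 1 ω) *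
      prob p ((connEvent ends s t)ᶜ ∩ clusterInEvent ends s ({W : Set V | ∀ x ∈ T, x ∉ W})) := by
  have h := bhk_induced p hp ends s hF₁ hF₂ hF₁0 hF₂0 Finset.univ (insert t T) (insert t T)
    (Finset.subset_univ _) (Finset.subset_univ _)
  simp only [Finset.inter_self, Finset.union_self, REvent_univ_insert] at h
  have e : ∀ F : Set V → R, clusterObs ends Finset.univ s F *
      ((connEvent ends s t)ᶜ ∩ clusterInEvent ends s ({W : Set V | ∀ x ∈ T, x ∉ W})).indicator 1 =
      fun ω => F (cluster ends ω s) *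
        ((connEvent ends s t)ᶜ ∩ clusterInEvent ends s ({W : Set V | ∀ x ∈ T, x ∉ W})).indicator 1 ω := by
    intro F
    funext ω
    simp only [Pi.mul_apply, clusterObs_apply, clusterIn_univ]
  rw [e, e, e] at h
  exact h

/-- **(F2)**: `P({W : Set V | ∀ x ∈ T, x ∉ W} ∩ {W : Set V | ∀ x ∈ T, x ∉ W}′, Q) · P(Q) ≥ P({W : Set V | ∀ x ∈ T, x ∉ W}, Q) · P({W : Set V | ∀ x ∈ T, x ∉ W}′, Q)`. -/
theorem avoid_pa (p : E → R) (hp : IsProbVec p) (ends : E → Sym2 V) (s t : V) (T T' : Finset V) :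
    prob p (clusterInEvent ends s ({W : Set V | ∀ x ∈ T, x ∉ W}) ∩ (connEvent ends s t)ᶜ) *
        prob p (clusterInEvent ends s ({W : Set V | ∀ x ∈ T', x ∉ W}) ∩ (connEvent ends s t)ᶜ) ≤
      prob p (clusterInEvent ends s ({W : Set V | ∀ x ∈ T, x ∉ W} ∩ {W : Set V | ∀ x ∈ T', x ∉ W}) ∩ (connEvent ends s t)ᶜ) *
        prob p (connEvent ends s t)ᶜ := by
  have h := bhk_induced p hp ends s (F₁ := fun _ => (1 : R)) (F₂ := fun _ => (1 : R))
    (fun _ _ _ => le_rfl) (fun _ _ _ => le_rfl) (fun _ => zero_le_one) (fun _ => zero_le_one)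
    Finset.univ (insert t T) (insert t T') (Finset.subset_univ _) (Finset.subset_univ _)
  have eX : insert t T ∪ insert t T' = insert t (T ∪ T') := by
    ext x
    simp only [Finset.mem_union, Finset.mem_insert]
    tauto
  have eY : insert t T ∩ insert t T' = insert t (T ∩ T') := by
    ext x
    simp only [Finset.mem_inter, Finset.mem_insert]
    tauto
  rw [eX, eY] at h
  simp only [REvent_univ_insert, avoid_union] at h
  have e1 : ∀ T₀ : Finset V, expect p (clusterObs ends Finset.univ s (fun _ => (1 : R)) *
      ((connEvent ends s t)ᶜ ∩ clusterInEvent ends s ({W : Set V | ∀ x ∈ T₀, x ∉ W})).indicator 1) =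
      prob p (clusterInEvent ends s ({W : Set V | ∀ x ∈ T₀, x ∉ W}) ∩ (connEvent ends s t)ᶜ) := by
    intro T₀
    rw [prob_eq_expect_indicator, Set.inter_comm]
    congr 1
    funext ω
    simp only [Pi.mul_apply, clusterObs_apply, one_mul]
  have e1' : expect p (clusterObs ends Finset.univ s ((fun _ => (1 : R)) * fun _ => (1 : R)) *
      ((connEvent ends s t)ᶜ ∩ clusterInEvent ends s ({W : Set V | ∀ x ∈ T ∩ T', x ∉ W})).indicator 1) =
      prob p (clusterInEvent ends s ({W : Set V | ∀ x ∈ T ∩ T', x ∉ W}) ∩ (connEvent ends s t)ᶜ) := by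
    rw [prob_eq_expect_indicator, Set.inter_comm]
    congr 1
    funext ω
    simp only [Pi.mul_apply, clusterObs_apply, one_mul]
  rw [e1, e1, e1'] at h
  have hle : prob p (clusterInEvent ends s ({W : Set V | ∀ x ∈ T ∩ T', x ∉ W}) ∩ (connEvent ends s t)ᶜ) ≤
      prob p (connEvent ends s t)ᶜ := prob_mono hp Set.inter_subset_right
  have c : prob p ((connEvent ends s t)ᶜ ∩ clusterInEvent ends s ({W : Set V | ∀ x ∈ T, x ∉ W} ∩ {W : Set V | ∀ x ∈ T', x ∉ W})) =
      prob p (clusterInEvent ends s ({W : Set V | ∀ x ∈ T, x ∉ W} ∩ {W : Set V | ∀ x ∈ T', x ∉ W}) ∩ (connEvent ends s t)ᶜ) := by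
    rw [Set.inter_comm]
  have h0 : 0 ≤ prob p (clusterInEvent ends s ({W : Set V | ∀ x ∈ T, x ∉ W} ∩ {W : Set V | ∀ x ∈ T', x ∉ W}) ∩ (connEvent ends s t)ᶜ) :=
    prob_nonneg hp _
  rw [c] at h
  calc prob p (clusterInEvent ends s ({W : Set V | ∀ x ∈ T, x ∉ W}) ∩ (connEvent ends s t)ᶜ) *
        prob p (clusterInEvent ends s ({W : Set V | ∀ x ∈ T', x ∉ W}) ∩ (connEvent ends s t)ᶜ)
      ≤ prob p (clusterInEvent ends s ({W : Set V | ∀ x ∈ T ∩ T', x ∉ W}) ∩ (connEvent ends s t)ᶜ) *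
          prob p (clusterInEvent ends s ({W : Set V | ∀ x ∈ T, x ∉ W} ∩ {W : Set V | ∀ x ∈ T', x ∉ W}) ∩ (connEvent ends s t)ᶜ) := h
    _ ≤ prob p (connEvent ends s t)ᶜ *
          prob p (clusterInEvent ends s ({W : Set V | ∀ x ∈ T, x ∉ W} ∩ {W : Set V | ∀ x ∈ T', x ∉ W}) ∩ (connEvent ends s t)ᶜ) :=
        mul_le_mul_of_nonneg_right hle h0
    _ = _ := mul_comm _ _

/-- **(F1)**: `P({W : Set V | ∀ x ∈ T, x ∉ W} ∩ {W : Set V | ∀ x ∈ T, x ∉ W}′, C_t ∈ 𝓤, Q) · P({W : Set V | ∀ x ∈ T, x ∉ W}′, Q) ≥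
P({W : Set V | ∀ x ∈ T, x ∉ W}′, C_t ∈ 𝓤, Q) · P({W : Set V | ∀ x ∈ T, x ∉ W} ∩ {W : Set V | ∀ x ∈ T, x ∉ W}′, Q)`. -/
theorem cond_raises (p : E → R) (hp : IsProbVec p) (ends : E → Sym2 V) (s t : V)
    {𝓤 : Set (Set V)} (h𝓤 : IsUpperSet 𝓤) (T T' : Finset V) :
    prob p (clusterInEvent ends s ({W : Set V | ∀ x ∈ T', x ∉ W}) ∩ clusterInEvent ends t 𝓤 ∩ (connEvent ends s t)ᶜ) *
        prob p (clusterInEvent ends s ({W : Set V | ∀ x ∈ T, x ∉ W} ∩ {W : Set V | ∀ x ∈ T', x ∉ W}) ∩ (connEvent ends s t)ᶜ) ≤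
      prob p (clusterInEvent ends s ({W : Set V | ∀ x ∈ T, x ∉ W} ∩ {W : Set V | ∀ x ∈ T', x ∉ W}) ∩ clusterInEvent ends t 𝓤 ∩
          (connEvent ends s t)ᶜ) *
        prob p (clusterInEvent ends s ({W : Set V | ∀ x ∈ T', x ∉ W}) ∩ (connEvent ends s t)ᶜ) := by
  classical
  set g := delClusterProb p ends t 𝓤 with hg
  have hg_anti : Antitone g := delClusterProb_anti p hp ends t h𝓤
  have hg0 : ∀ W, 0 ≤ g W := delClusterProb_nonneg p hp ends t 𝓤
  have hg1 : ∀ W, g W ≤ 1 := delClusterProb_le_one p hp ends t 𝓤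
  -- `F₁ = 1 − g` (monotone, in `[0,1]`), `F₂ = 1 − 1_{{W : Set V | ∀ x ∈ T, x ∉ W}}` (monotone indicator of the up-set)
  set v := ({W : Set V | ∀ x ∈ T, x ∉ W}).indicator (1 : Set V → R) with hv
  have hv_anti : Antitone v := antitone_indicator_avoid T
  have hv0 : ∀ W, 0 ≤ v W := fun W => Set.indicator_apply_nonneg fun _ => zero_le_one
  have hv1 : ∀ W, v W ≤ 1 := indicator_one_le_one ({W : Set V | ∀ x ∈ T, x ∉ W})
  have hF₁ : Monotone (fun W => 1 - g W) := fun W W' h => by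
    simp only
    linarith [hg_anti h]
  have hF₂ : Monotone (fun W => 1 - v W) := fun W W' h => by
    simp only
    linarith [hv_anti h]
  have hF₁0 : ∀ W, 0 ≤ 1 - g W := fun W => by linarith [hg1 W]
  have hF₂0 : ∀ W, 0 ≤ 1 - v W := fun W => by linarith [hv1 W]
  have key := bhk_same_cluster_R p hp ends s t T' hF₁ hF₂ hF₁0 hF₂0
  -- the masses
  set Rev := (connEvent ends s t)ᶜ ∩ clusterInEvent ends s ({W : Set V | ∀ x ∈ T', x ∉ W}) with hRev
  have eR : prob p Rev = prob p (clusterInEvent ends s ({W : Set V | ∀ x ∈ T', x ∉ W}) ∩ (connEvent ends s t)ᶜ) := by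
    rw [hRev, Set.inter_comm]
  -- `E[g 1_R] = P({W : Set V | ∀ x ∈ T, x ∉ W}′, C_t ∈ 𝓤, Q)`
  have eg : expect p (fun ω => g (cluster ends ω s) * Rev.indicator 1 ω) =
      prob p (clusterInEvent ends s ({W : Set V | ∀ x ∈ T', x ∉ W}) ∩ clusterInEvent ends t 𝓤 ∩
        (connEvent ends s t)ᶜ) := by
    rw [prob_clusterIn_inter_eq_expect]
    congr 1
    funext ω
    rw [hRev, indicator_inter_one, indicator_clusterInEvent]
    ring
  -- `E[g 1_{{W : Set V | ∀ x ∈ T, x ∉ W}}(C_s) 1_R] = P({W : Set V | ∀ x ∈ T, x ∉ W} ∩ {W : Set V | ∀ x ∈ T, x ∉ W}′, C_t ∈ 𝓤, Q)`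
  have egv : expect p (fun ω => g (cluster ends ω s) * v (cluster ends ω s) * Rev.indicator 1 ω) =
      prob p (clusterInEvent ends s ({W : Set V | ∀ x ∈ T, x ∉ W} ∩ {W : Set V | ∀ x ∈ T', x ∉ W}) ∩ clusterInEvent ends t 𝓤 ∩
        (connEvent ends s t)ᶜ) := by
    rw [prob_clusterIn_inter_eq_expect]
    congr 1
    funext ω
    rw [hRev, indicator_inter_one, indicator_clusterInEvent, hv, Set.inter_indicator_one,
      Pi.mul_apply]
    ring
  -- `E[1_{{W : Set V | ∀ x ∈ T, x ∉ W}}(C_s) 1_R] = P({W : Set V | ∀ x ∈ T, x ∉ W} ∩ {W : Set V | ∀ x ∈ T, x ∉ W}′, Q)`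
  have ev : expect p (fun ω => v (cluster ends ω s) * Rev.indicator 1 ω) =
      prob p (clusterInEvent ends s ({W : Set V | ∀ x ∈ T, x ∉ W} ∩ {W : Set V | ∀ x ∈ T', x ∉ W}) ∩ (connEvent ends s t)ᶜ) := by
    rw [prob_eq_expect_indicator]
    congr 1
    funext ω
    rw [hRev, indicator_inter_one, indicator_inter_one, indicator_clusterInEvent,
      indicator_clusterInEvent, hv, Set.inter_indicator_one, Pi.mul_apply]
    ring
  have eRe : expect p (fun ω => Rev.indicator 1 ω) = prob p Rev :=
    (prob_eq_expect_indicator p _).symm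
  -- rewrite the three expectations of `key`
  have k1 : expect p (fun ω => (1 - g (cluster ends ω s)) * Rev.indicator 1 ω) =
      prob p Rev - prob p (clusterInEvent ends s ({W : Set V | ∀ x ∈ T', x ∉ W}) ∩ clusterInEvent ends t 𝓤 ∩
        (connEvent ends s t)ᶜ) := by
    rw [← eg, ← eRe, ← expect_sub]
    congr 1
    funext ω
    simp only [Pi.sub_apply]
    ring
  have k2 : expect p (fun ω => (1 - v (cluster ends ω s)) * Rev.indicator 1 ω) =
      prob p Rev - prob p (clusterInEvent ends s ({W : Set V | ∀ x ∈ T, x ∉ W} ∩ {W : Set V | ∀ x ∈ T', x ∉ W}) ∩ (connEvent ends s t)ᶜ) := by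
    rw [← ev, ← eRe, ← expect_sub]
    congr 1
    funext ω
    simp only [Pi.sub_apply]
    ring
  have k3 : expect p (fun ω => (1 - g (cluster ends ω s)) * (1 - v (cluster ends ω s)) *
      Rev.indicator 1 ω) =
      prob p Rev - prob p (clusterInEvent ends s ({W : Set V | ∀ x ∈ T', x ∉ W}) ∩ clusterInEvent ends t 𝓤 ∩
        (connEvent ends s t)ᶜ) -
        prob p (clusterInEvent ends s ({W : Set V | ∀ x ∈ T, x ∉ W} ∩ {W : Set V | ∀ x ∈ T', x ∉ W}) ∩ (connEvent ends s t)ᶜ) +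
        prob p (clusterInEvent ends s ({W : Set V | ∀ x ∈ T, x ∉ W} ∩ {W : Set V | ∀ x ∈ T', x ∉ W}) ∩ clusterInEvent ends t 𝓤 ∩
          (connEvent ends s t)ᶜ) := by
    rw [← egv, ← ev, ← eg, ← eRe, ← expect_sub, ← expect_sub, ← expect_add]
    congr 1
    funext ω
    simp only [Pi.sub_apply, Pi.add_apply]
    ring
  rw [k1, k2, k3, eR] at key
  nlinarith [key]

end Avoid

section Main

variable {V : Type*} {E : Type*} [Fintype E] [DecidableEq E] [Fintype V] [DecidableEq V]
  {R : Type*} [CommRing R] [LinearOrder R] [IsStrictOrderedRing R]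

/-- **Theorem B (the R-product inequality)**: with `a = P({W : Set V | ∀ x ∈ T, x ∉ W} ∩ {W : Set V | ∀ x ∈ T, x ∉ W}′; 𝓤)`,
`m = P({W : Set V | ∀ x ∈ T, x ∉ W} ∩ {W : Set V | ∀ x ∈ T, x ∉ W}′)`, `b = P({W : Set V | ∀ x ∈ T, x ∉ W}′; 𝓤)`, `m′ = P({W : Set V | ∀ x ∈ T, x ∉ W}′)`, `m_T = P({W : Set V | ∀ x ∈ T, x ∉ W})`,
`f₀ = P(C_t ∈ 𝓤, Q)`, `P = P(Q)`: `m_T·(b·P − f₀·m′) ≤ (a·P − f₀·m)·P`, i.e.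
`Cov_Q(1_𝓤(C_t), 1[C_s ∩ T = ∅]·1[C_s ∩ T′ = ∅]) ≥ P_Q(C_s ∩ T = ∅) · Cov_Q(1_𝓤(C_t), 1[C_s ∩ T′ = ∅])`. -/
theorem r_product (p : E → R) (hp : IsProbVec p) (ends : E → Sym2 V) (s t : V)
    {𝓤 : Set (Set V)} (h𝓤 : IsUpperSet 𝓤) (T T' : Finset V) :
    prob p (clusterInEvent ends s ({W : Set V | ∀ x ∈ T, x ∉ W}) ∩ (connEvent ends s t)ᶜ) *
      (prob p (clusterInEvent ends s ({W : Set V | ∀ x ∈ T', x ∉ W}) ∩ clusterInEvent ends t 𝓤 ∩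
          (connEvent ends s t)ᶜ) * prob p (connEvent ends s t)ᶜ -
        prob p (clusterInEvent ends t 𝓤 ∩ (connEvent ends s t)ᶜ) *
          prob p (clusterInEvent ends s ({W : Set V | ∀ x ∈ T', x ∉ W}) ∩ (connEvent ends s t)ᶜ)) ≤
    (prob p (clusterInEvent ends s ({W : Set V | ∀ x ∈ T, x ∉ W} ∩ {W : Set V | ∀ x ∈ T', x ∉ W}) ∩ clusterInEvent ends t 𝓤 ∩
          (connEvent ends s t)ᶜ) * prob p (connEvent ends s t)ᶜ -
        prob p (clusterInEvent ends t 𝓤 ∩ (connEvent ends s t)ᶜ) *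
          prob p (clusterInEvent ends s ({W : Set V | ∀ x ∈ T, x ∉ W} ∩ {W : Set V | ∀ x ∈ T', x ∉ W}) ∩ (connEvent ends s t)ᶜ)) *
      prob p (connEvent ends s t)ᶜ := by
  classical
  -- the masses
  set a := prob p (clusterInEvent ends s ({W : Set V | ∀ x ∈ T, x ∉ W} ∩ {W : Set V | ∀ x ∈ T', x ∉ W}) ∩ clusterInEvent ends t 𝓤 ∩
    (connEvent ends s t)ᶜ) with ha
  set m := prob p (clusterInEvent ends s ({W : Set V | ∀ x ∈ T, x ∉ W} ∩ {W : Set V | ∀ x ∈ T', x ∉ W}) ∩ (connEvent ends s t)ᶜ) with hm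
  set b := prob p (clusterInEvent ends s ({W : Set V | ∀ x ∈ T', x ∉ W}) ∩ clusterInEvent ends t 𝓤 ∩
    (connEvent ends s t)ᶜ) with hb
  set m' := prob p (clusterInEvent ends s ({W : Set V | ∀ x ∈ T', x ∉ W}) ∩ (connEvent ends s t)ᶜ) with hm'
  set mT := prob p (clusterInEvent ends s ({W : Set V | ∀ x ∈ T, x ∉ W}) ∩ (connEvent ends s t)ᶜ) with hmT
  set f₀ := prob p (clusterInEvent ends t 𝓤 ∩ (connEvent ends s t)ᶜ) with hf₀
  set P := prob p (connEvent ends s t)ᶜ with hP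
  -- (F1a): `a m′ ≥ b m`
  have F1a : b * m ≤ a * m' := cond_raises p hp ends s t h𝓤 T T'
  -- (F1b): `b P ≥ f₀ m′` — (F1) with `(T′, ∅)`
  have F1b : f₀ * m' ≤ b * P := by
    have h := cond_raises p hp ends s t h𝓤 T' ∅
    have e0 : {W : Set V | ∀ x ∈ (∅ : Finset V), x ∉ W} = Set.univ := avoid_empty
    have eu : clusterInEvent ends s (Set.univ : Set (Set V)) = Set.univ := by
      ext ω; simp [clusterInEvent]
    simp only [e0, Set.inter_univ, eu, Set.univ_inter] at h
    exact h
  -- (F2): `m P ≥ m_T m′`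
  have F2 : mT * m' ≤ m * P := avoid_pa p hp ends s t T T'
  -- nonnegativity and the trivial bounds
  have ha0 : 0 ≤ a := prob_nonneg hp _
  have hb0 : 0 ≤ b := prob_nonneg hp _
  have hm0 : 0 ≤ m := prob_nonneg hp _
  have hm'0 : 0 ≤ m' := prob_nonneg hp _
  have hP0 : 0 ≤ P := prob_nonneg hp _
  have ham : a ≤ m := prob_mono hp fun ω hω => ⟨hω.1.1, hω.2⟩
  have hbm' : b ≤ m' := prob_mono hp fun ω hω => ⟨hω.1.1, hω.2⟩
  have hmm' : m ≤ m' := prob_mono hp fun ω hω => ⟨hω.1.2, hω.2⟩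
  -- `D₂ = bP − f₀m′ ≥ 0`, `D₁ m′ ≥ m D₂`, `P m D₂ ≥ m_T m′ D₂`
  have hD₂ : 0 ≤ b * P - f₀ * m' := by linarith
  have h1 : m * (b * P - f₀ * m') ≤ (a * P - f₀ * m) * m' := by nlinarith [F1a, hP0]
  have h2 : mT * m' * (b * P - f₀ * m') ≤ m * P * (b * P - f₀ * m') :=
    mul_le_mul_of_nonneg_right F2 hD₂
  have h3 : 0 ≤ m' * ((a * P - f₀ * m) * P - mT * (b * P - f₀ * m')) := by nlinarith [h1, h2, hP0]
  rcases eq_or_lt_of_le hm'0 with hz | hpos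
  · -- `m′ = 0` forces `a = b = m = 0`
    rw [← hz] at hbm' hmm'
    have hb' : b = 0 := le_antisymm hbm' hb0
    have hmz : m = 0 := le_antisymm hmm' hm0
    rw [hmz] at ham
    have haz : a = 0 := le_antisymm ham ha0
    rw [hb', hmz, haz, ← hz]
    ring_nf
    exact le_rfl
  · have := nonneg_of_mul_nonneg_right h3 hpos
    linarith

omit [Fintype E] [DecidableEq E] [Fintype V] [DecidableEq V] in
/-- `{W : Set V | ∀ x ∈ ({v} : Finset V), x ∉ W} = {W | v ∉ W}` and `{C_x ∈ {W : Set V | ∀ x ∈ ({v} : Finset V), x ∉ W}} = {x ↮ v}`. -/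
lemma clusterInEvent_avoid_singleton (ends : E → Sym2 V) (x v : V) :
    clusterInEvent ends x ({W : Set V | ∀ x ∈ ({v} : Finset V), x ∉ W}) = (connEvent ends x v)ᶜ := by
  ext ω
  simp [clusterInEvent, cluster, connEvent]

omit [Fintype E] [DecidableEq E] [Fintype V] [DecidableEq V] in
/-- `{C_x ∈ avoid {v} ∩ avoid {v′}} = {x ↮ v} ∩ {x ↮ v′}`. -/
lemma clusterInEvent_avoid_pair (ends : E → Sym2 V) (x v v' : V) :
    clusterInEvent ends x ({W : Set V | ∀ x ∈ ({v} : Finset V), x ∉ W} ∩ {W : Set V | ∀ x ∈ ({v'} : Finset V), x ∉ W}) = (connEvent ends x v)ᶜ ∩ (connEvent ends x v')ᶜ := by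
  ext ω
  simp [clusterInEvent, cluster, connEvent]

omit [Fintype E] [DecidableEq E] [Fintype V] [DecidableEq V] in
/-- `{C_x ∈ {W | v ∈ W}} = {x ↔ v}`. -/
lemma clusterInEvent_mem_eq (ends : E → Sym2 V) (x v : V) :
    clusterInEvent ends x {W : Set V | v ∈ W} = connEvent ends x v := by
  ext ω
  simp [clusterInEvent, cluster, connEvent]

/-- **(SUB2)** (proofs/MINE2-JOINTPA.md Corollary B1): roots `a₁, a₂`, vertices `b, o, u`,
`Q = {a₂ ↮ a₁}`, `L_b = {b ∈ C₁}`, `M_o = {o ∉ C₂}`, `M_u = {u ∉ C₂}`: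
`Cov_Q(L_b, M_o M_u) ≥ P_Q(M_o) · Cov_Q(L_b, M_u)` (multiplied out by `P(Q)³`), i.e.
`|Cov_Q(L_b, H_oH_u)| ≤ |Cov_Q(L_b, H_o)| + P_Q(o ∈ C₂) · |Cov_Q(L_b, H_u)|`. -/
theorem sub2 (p : E → R) (hp : IsProbVec p) (ends : E → Sym2 V) (a₁ a₂ b o u : V) :
    prob p ((connEvent ends a₂ o)ᶜ ∩ (connEvent ends a₂ a₁)ᶜ) *
      (prob p ((connEvent ends a₂ u)ᶜ ∩ connEvent ends a₁ b ∩ (connEvent ends a₂ a₁)ᶜ) *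
          prob p (connEvent ends a₂ a₁)ᶜ -
        prob p (connEvent ends a₁ b ∩ (connEvent ends a₂ a₁)ᶜ) *
          prob p ((connEvent ends a₂ u)ᶜ ∩ (connEvent ends a₂ a₁)ᶜ)) ≤
    (prob p ((connEvent ends a₂ o)ᶜ ∩ (connEvent ends a₂ u)ᶜ ∩ connEvent ends a₁ b ∩
          (connEvent ends a₂ a₁)ᶜ) * prob p (connEvent ends a₂ a₁)ᶜ -
        prob p (connEvent ends a₁ b ∩ (connEvent ends a₂ a₁)ᶜ) *
          prob p ((connEvent ends a₂ o)ᶜ ∩ (connEvent ends a₂ u)ᶜ ∩ (connEvent ends a₂ a₁)ᶜ)) *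
      prob p (connEvent ends a₂ a₁)ᶜ := by
  have h𝓤 : IsUpperSet {W : Set V | b ∈ W} := fun _ _ h hW => h hW
  have key := r_product p hp ends a₂ a₁ h𝓤 {o} {u}
  rw [clusterInEvent_avoid_singleton, clusterInEvent_avoid_singleton, clusterInEvent_avoid_pair,
    clusterInEvent_mem_eq] at key
  exact key

end Main

end RProduct

end Summit.Ventures.PercRepro2
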